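import Literature.IUT.LogVolume.TensorPacketBaseExtension
import HarnessLib

/-!
# Base extension of a tensor packet, II: factorwise LATTICE RETRACTIONS ⇒ the log-shell lattice is saturated
# along `φ = ⊗σ_i` ⇒ item (X) of the G1-Θ memo at every prime

abc-iut cell, prover seat abc-iut-w5-d036 (gen 5); sequel to `TensorPacketBaseExtension` (along a packet morphism
`φ` with `φ(ι_i(a)) = ι'_i(σ_i a)` and SATURATED log-shell preimage `φ⁻¹(log_p(R'_I^×)) ⊆ log_p(R_I^×)` the content is
non-increasing and the (Ind2)-orbit hull volume of the slot-union non-decreasing). HERE the saturation hypothesis is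
DISCHARGED from factorwise data that are classical for `p`-adic fields: for every factor a `ℚ_p`-LINEAR RETRACTION
`r_i : k'_i → k_i` of the embedding `σ_i` (`r_i ∘ σ_i = id`) mapping `log_p(R'_i^×)` into `log_p(R_i^×)` — e.g. the
normalised trace `[k'_i:k_i]⁻¹·Tr_{k'_i/k_i}` when `p ∤ [k'_i : k_i]` and both factors are tame (`log_p = 𝔪`), or the
coordinate projection of a power basis in general. PROVED:

* `map_purePacket_eq_of_retraction` — `ρ := ⊗_i r_i` (Mathlib `PiTensorProduct.map`) satisfies `ρ ∘ φ = id` on `V`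
  (both are linear and agree on pure tensors);
* `image_logPacket_subset_of_retraction` — `ρ(log_p(R'_I^×)) ⊆ log_p(R_I^×)` (pure tensors of log-units go to pure
  tensors of log-units; the EASY direction);
* **`sat_of_retraction`** — hence `φ(x) ∈ log_p(R'_I^×) ⇒ x = ρ(φ x) ∈ log_p(R_I^×)`: the saturation `hsat`;
* **`packetLogμ_packetHull_orbit_slotUnion_le_of_retraction`** — item (X): for slot elements `g_i ∈ k_i^×`,
  `log μ̄(hull(⋃_γ γ·⋃_i ι_i(g_i)·(R_I)^∼)) ≤ log μ̄'(hull'(⋃_{γ'} γ'·⋃_i ι'_i(σ_i g_i)·(R'_I)^∼))`, at EVERY prime, for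
  field embeddings admitting such retractions.

HONEST SCOPE. The retractions are explicit hypotheses (data + two properties), not `Prop` facts; their existence
for a given pair `k_i ⊆ k'_i` is classical local algebra (trace / integral power bases) and is NOT constructed in this
file. Classical lattice algebra over the tree's typings of (Ind2)/the hull of the disputed corpus [claim:
Mochizuki2012, status: disputed]; nothing here takes a side on [IUTchIII] Cor. 3.12; typed ≠ proved. PROOF-ONLY file:
no definitions. [cite: Mochizuki2012, IUTchIV Prop. 1.2 (ii) p. 10] [cite: DupuyHilado2025, §4.7, §4.9, §4.12]
-/

noncomputable section

open Set Module
open scoped Pointwise TensorProduct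

namespace Literature.IUT.LogVolume

variable (p : ℕ) [Fact p.Prime]
variable {I : Type} [Fintype I] [DecidableEq I] [Nonempty I]
variable (k : I → Type) [∀ i, NontriviallyNormedField (k i)] [∀ i, NormedAlgebra ℚ_[p] (k i)]
  [∀ i, IsUltrametricDist (k i)] [∀ i, ProperSpace (k i)]
variable (k' : I → Type) [∀ i, NontriviallyNormedField (k' i)] [∀ i, NormedAlgebra ℚ_[p] (k' i)]
  [∀ i, IsUltrametricDist (k' i)] [∀ i, ProperSpace (k' i)]
variable (φ : PacketAlgebra p k →ₐ[ℚ_[p]] PacketAlgebra p k')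
variable (σ : ∀ i, k i →ₐ[ℚ_[p]] k' i) (hφ : ∀ (i : I) (a : k i), φ (iota p k i a) = iota p k' i (σ i a))
variable (r : ∀ i, k' i →ₗ[ℚ_[p]] k i) (hr : ∀ (i : I) (a : k i), r i (σ i a) = a)

omit [Fintype I] [DecidableEq I] [Nonempty I] [∀ i, IsUltrametricDist (k i)] [∀ i, ProperSpace (k i)]
  [∀ i, IsUltrametricDist (k' i)] [∀ i, ProperSpace (k' i)] in
/-- `(⊗_i r_i)(⊗_i y_i) = ⊗_i r_i(y_i)`. [cite: Mochizuki2012, IUTchIV Prop. 1.1 p. 9] -/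
theorem map_purePacket_eq (y : Π i, k' i) :
    PiTensorProduct.map r (purePacket p k' y) = purePacket p k (fun i => r i (y i)) :=
  PiTensorProduct.map_tprod r y

omit [Nonempty I] [∀ i, IsUltrametricDist (k i)] [∀ i, ProperSpace (k i)]
  [∀ i, IsUltrametricDist (k' i)] [∀ i, ProperSpace (k' i)] in
include hφ hr in
/-- **`ρ ∘ φ = id`** for `ρ := ⊗_i r_i` and a packet morphism `φ` with `φ(ι_i(a)) = ι'_i(σ_i a)`, the `r_i` being
retractions of the `σ_i` (both sides are `ℚ_p`-linear and agree on pure tensors). [cite: Mochizuki2012, IUTchIV Prop. 1.1 p. 9] -/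
theorem map_comp_eq_id_of_retraction (x : PacketAlgebra p k) : PiTensorProduct.map r (φ x) = x := by
  have h : (PiTensorProduct.map r).comp φ.toLinearMap = LinearMap.id := by
    refine PiTensorProduct.ext ?_
    ext y
    change PiTensorProduct.map r (φ (purePacket p k y)) = purePacket p k y
    have hy : (fun i => r i (σ i (y i))) = y := funext fun i => hr i (y i)
    rw [map_purePacket_of_iota p k k' φ σ hφ y, map_purePacket_eq p k k' r, hy]
  exact LinearMap.congr_fun h x

omit [Fintype I] [DecidableEq I] [Nonempty I] [∀ i, IsUltrametricDist (k i)] [∀ i, ProperSpace (k i)]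
  [∀ i, IsUltrametricDist (k' i)] [∀ i, ProperSpace (k' i)] in
/-- **`ρ(log_p(R'_I^×)) ⊆ log_p(R_I^×)`** when every `r_i` maps `log_p(R'_i^×)` into `log_p(R_i^×)` (the lattice is
generated by pure tensors of log-units, which `ρ` maps to pure tensors of log-units).
[cite: Mochizuki2012, IUTchIV Prop. 1.2 (ii) p. 10] -/
theorem image_logPacket_subset_of_retraction
    (hrΛ : ∀ (i : I) (z : k' i), z ∈ logUnits (k' i) → r i z ∈ logUnits (k i)) {y : PacketAlgebra p k'}
    (hy : y ∈ logPacket p k') : PiTensorProduct.map r y ∈ logPacket p k := by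
  have h : logPacket p k' ≤ (logPacket p k).comap (PiTensorProduct.map r).toAddMonoidHom := by
    rw [logPacket]
    refine (AddSubgroup.closure_le _).mpr ?_
    rintro _ ⟨z, hz, rfl⟩
    rw [SetLike.mem_coe, AddSubgroup.mem_comap, LinearMap.toAddMonoidHom_coe, map_purePacket_eq]
    exact purePacket_mem_logPacket_of_mem p k fun i => hrΛ i (z i) (hz i)
  exact h hy

omit [Nonempty I] [∀ i, IsUltrametricDist (k i)] [∀ i, ProperSpace (k i)]
  [∀ i, IsUltrametricDist (k' i)] [∀ i, ProperSpace (k' i)] in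
include hφ hr in
/-- **Saturation from retractions**: `φ(x) ∈ log_p(R'_I^×) ⇒ x ∈ log_p(R_I^×)` (`x = ρ(φ x)`).
[cite: Mochizuki2012, IUTchIV Prop. 1.2 (ii) p. 10] [cite: DupuyHilado2025, §4.9] -/
theorem sat_of_retraction
    (hrΛ : ∀ (i : I) (z : k' i), z ∈ logUnits (k' i) → r i z ∈ logUnits (k i)) (x : PacketAlgebra p k)
    (hx : φ x ∈ (logPacket p k' : Set (PacketAlgebra p k'))) : x ∈ (logPacket p k : Set (PacketAlgebra p k)) := by
  rw [SetLike.mem_coe, ← map_comp_eq_id_of_retraction p k k' φ σ hφ r hr x]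
  exact image_logPacket_subset_of_retraction p k k' r hrΛ hx

include hφ hr in
/-- **Item (X) of the G1-Θ memo at EVERY prime, from factorwise lattice retractions**: for field embeddings
`σ_i : k_i → k'_i` admitting `ℚ_p`-linear retractions `r_i` that map `log_p(R'_i^×)` into `log_p(R_i^×)`, a packet
morphism `φ` with `φ(ι_i(a)) = ι'_i(σ_i a)`, and slot elements `g_i ∈ k_i^×`:
`log μ̄(hull(⋃_γ γ·⋃_i ι_i(g_i)·(R_I)^∼)) ≤ log μ̄'(hull'(⋃_{γ'} γ'·⋃_i ι'_i(σ_i g_i)·(R'_I)^∼))` — the normalised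
log-volume of the (Ind2)-orbit hull of the (Ind1) slot-union does not decrease when the local fields are enlarged and
the Θ-values are carried along. [cite: Mochizuki2012, IUTchIV Thm 1.10 proof Step (v) p. 27–28] [cite: DupuyHilado2025, §4.7, §4.12] -/
theorem packetLogμ_packetHull_orbit_slotUnion_le_of_retraction
    (hrΛ : ∀ (i : I) (z : k' i), z ∈ logUnits (k' i) → r i z ∈ logUnits (k i))
    (g : Π i, k i) (hg : ∀ i, g i ≠ 0) :
    packetLogμ p k (packetHull p k
        (⋃ γ : indTwo p k, γ • ⋃ i, iota p k i (g i) • (normalizedPacket p k : Set (PacketAlgebra p k)))) ≤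
      packetLogμ p k' (packetHull p k'
        (⋃ γ : indTwo p k', γ • ⋃ i, iota p k' i (σ i (g i)) •
          (normalizedPacket p k' : Set (PacketAlgebra p k')))) :=
  packetLogμ_packetHull_orbit_slotUnion_le_of_sat p k k' φ σ hφ
    (sat_of_retraction p k k' φ σ hφ r hr hrΛ) g hg

end Literature.IUT.LogVolume

end
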